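import Mathlib
import HarnessLib
import Summits.ValiantsHypothesis.ValiantsHypothesis.Theses.MonotoneRestoration
import Literature.Computability.AlgebraicComplexity.ArithCircuit
import Literature.Computability.AlgebraicComplexity.ArithCircuitProofs
import Literature.Computability.AlgebraicComplexity.MonotoneStructure
import Literature.Computability.AlgebraicComplexity.PermanentIrreducible
import Literature.ModelTheory.FiniteModelTheory.CkEquiv
import Summits.ValiantsHypothesis.ValiantsHypothesis.Theorems.MonotoneRestorationMonotoneRestorationQPCosetCount
import Summits.ValiantsHypothesis.ValiantsHypothesis.Theorems.MonotoneRestorationMonotoneRestorationQPSymmetricLB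
import Summits.ValiantsHypothesis.ValiantsHypothesis.Theorems.MonotoneRestorationMonotoneRestorationQPSupportSymmetrisation
import Summits.ValiantsHypothesis.ValiantsHypothesis.Theorems.MonotoneRestorationMonotoneRestorationQPSparseRegime
import Summits.ValiantsHypothesis.ValiantsHypothesis.Theorems.MonotoneRestorationMonotoneRestorationQPBeta
import Literature.Computability.AlgebraicComplexity.SymmetricArithCircuit
import Literature.Computability.AlgebraicComplexity.DawarWilsenach2025Proofs
import Literature.GroupTheory.PermutationGroups.SmallIndexSubgroups
import Summits.ValiantsHypothesis.ValiantsHypothesis.Theorems.MonotoneRestorationQP.Negative.LoadBearing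
import Summits.ValiantsHypothesis.ValiantsHypothesis.Theorems.MonotoneRestorationMonotoneRestorationQPPermSupportCount

/-! TTRL-lite variant V19127 of stmt-ValiantsHypothesis-15886 -/

set_option linter.dupNamespace false

namespace Summit.ValiantsHypothesis.ValiantsHypothesis.Theorems

open Summit.ValiantsHypothesis.ValiantsHypothesis.Theses.MonotoneRestoration
open Literature.Computability.AlgebraicComplexity

/-- TTRL-lite variant V19127 (expansion lemma) of `stmt-ValiantsHypothesis-15886`
(`stub_esymmRowSums_structure`): substituting the row sums `R_i = ∑ j, X (i, j)` into the
`k`-th elementary symmetric polynomial gives `e_k(R_1, …, R_n) = ∑_{|t| = k} ∏_{i ∈ t} R_i`.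
Immediate from the definition of `MvPolynomial.esymm` and the fact that `bind₁ _` is an
algebra homomorphism (`map_sum`, `map_prod`, `bind₁_X_right`). -/
theorem stub_esymmRowSums_structure_var19127 :
    ∀ (n k : ℕ), MvPolynomial.bind₁ (fun i : Fin n => ∑ j : Fin n, MvPolynomial.X (i, j))
      (MvPolynomial.esymm (Fin n) NNReal k) =
      ∑ t ∈ Finset.powersetCard k (Finset.univ : Finset (Fin n)), ∏ i ∈ t, ∑ j : Fin n,
        (MvPolynomial.X (i, j) : MvPolynomial (Fin n × Fin n) NNReal) := by
  intro n k
  rw [MvPolynomial.esymm, map_sum]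
  refine Finset.sum_congr rfl fun t _ => ?_
  rw [map_prod]
  refine Finset.prod_congr rfl fun i _ => ?_
  rw [MvPolynomial.bind₁_X_right]

end Summit.ValiantsHypothesis.ValiantsHypothesis.Theorems
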